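import Summits.CriticalPhenomena.Ising3DConformalLimit.Theorems.EnergyNotSigmaSquaredMoebiusLimitExistsDefs
import Summits.CriticalPhenomena.Ising3DConformalLimit.Theorems.MoebiusLimitExists.Negative.FreeTranslations

/-!
# `MoebiusLimit` (item stmt-CriticalPhenomena-1344), line `only-interaction-breaks-moebius`:
# translation invariance of a CONTINUOUS cluster point is free

Structural knowledge for the cluster-point lines of the crux (standing crux disprover gen 3, D-0016);
THEOREM-ONLY. For the zoom `F_k(x) = ρ(u_k)ⁿ ⟨σ_{[x₁/u_k]} ⋯ σ_{[xₙ/u_k]}⟩_{β_c}` of the critical `ℤ³`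
correlators along ANY mesh sequence `u_k → 0⁺` and ANY renormalisation `ρ`:
* `latticeApprox_add_eq`: `[(p + v)/δ] = [(p + w)/δ] + [v/δ]` with the correction vector
  `w = v − δ·[v/δ]`, `‖w‖ ≤ 2δ` (`norm_sub_smul_siteVec_latticeApprox_le`); by lattice translation
  invariance (`criticalCorr_translate`) `F_k(x + v) = F_k(x + w_k)` EXACTLY;
* `clusterPoint_translate_of_continuousOn`: hence a locally uniform limit `S n` that is continuous on
  `NonCoincident` is translation invariant there (`S n (x+v) = lim S n (x + w_k) = S n x`);
* `isRegular_of_clusterPoint`: for cluster points of the pinned zoom, `IsRegular` = normalised ∧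
  continuous off the diagonals — the translation clause is automatic (so the output of the lead's
  `compactnessSchema`, which is normalised and continuous, is already regular).
(The lead's `…MoebiusLimitExistsTranslationInvariant.lean` derives the same invariance from
asymptotic equicontinuity of the zoom instead of continuity of the limit.)
-/

noncomputable section

namespace Summit.CriticalPhenomena.Ising3DConformalLimit.MoebiusLimitExistsNegative

open Literature.Probability.LatticeModels Filter Set
open Summit.CriticalPhenomena.Ising3DConformalLimit.MoebiusLimitExistsOnlyInteraction
open scoped Topology

variable {S : CorrFamily 3}

/-! ### Translation invariance of CONTINUOUS cluster points is free -/

/-- The correction vector of a translation `v` at mesh `δ`: `w = v − δ·[v/δ]`, coordinates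
`δ·fract(vⱼ/δ) ∈ [0, δ)`; its norm is at most `2δ`. [folklore] -/
theorem norm_sub_smul_siteVec_latticeApprox_le {δ : ℝ} (hδ : 0 < δ) (v : EuclideanSpace ℝ (Fin 3)) :
    ‖v - δ • siteVec (latticeApprox δ v)‖ ≤ 2 * δ := by
  set w : EuclideanSpace ℝ (Fin 3) := v - δ • siteVec (latticeApprox δ v) with hw
  have hcoord : ∀ j, |w j| ≤ δ := by
    intro j
    have h1 : w j = δ * Int.fract (v j / δ) := by
      simp only [hw, PiLp.sub_apply, PiLp.smul_apply, siteVec_apply, latticeApprox_apply, smul_eq_mul,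
        Int.fract]
      field_simp
    rw [h1, abs_mul, abs_of_pos hδ, abs_of_nonneg (Int.fract_nonneg _)]
    exact mul_le_of_le_one_right hδ.le (Int.fract_lt_one _).le
  rw [EuclideanSpace.norm_eq]
  have hsum : ∑ j, ‖w j‖ ^ 2 ≤ (2 * δ) ^ 2 := by
    calc ∑ j, ‖w j‖ ^ 2 ≤ ∑ _j : Fin 3, δ ^ 2 := Finset.sum_le_sum fun j _ => by
            rw [Real.norm_eq_abs]
            exact pow_le_pow_left₀ (abs_nonneg _) (hcoord j) 2
      _ = 3 * δ ^ 2 := by simp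
      _ ≤ (2 * δ) ^ 2 := by nlinarith [sq_nonneg δ]
  calc Real.sqrt (∑ j, ‖w j‖ ^ 2) ≤ Real.sqrt ((2 * δ) ^ 2) := Real.sqrt_le_sqrt hsum
    _ = 2 * δ := Real.sqrt_sq (by linarith)

/-- At mesh `δ`, translating a configuration by `v` equals translating it by the small correction
vector `w = v − δ·[v/δ]` and then by the lattice vector `[v/δ]`:
`[(p + v)/δ] = [(p + w)/δ] + [v/δ]`. [folklore] -/
theorem latticeApprox_add_eq {δ : ℝ} (hδ : 0 < δ) (p v : EuclideanSpace ℝ (Fin 3)) :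
    latticeApprox δ (p + v) =
      latticeApprox δ (p + (v - δ • siteVec (latticeApprox δ v))) + latticeApprox δ v := by
  have h := latticeApprox_add_natMul_smul hδ (p + (v - δ • siteVec (latticeApprox δ v)))
    (latticeApprox δ v) 1
  simp only [Nat.cast_one, one_mul, one_smul] at h
  rw [← h]
  congr 1
  abel

/-- **Translation invariance of a CONTINUOUS cluster point is free.** If the `ρ`-rescaled `n`-point
correlators converge along a mesh sequence, locally uniformly on `NonCoincident`, to `S n`, and `S n` is
continuous on `NonCoincident`, then `S n (x + v) = S n x` there: the lattice correlators are
translation invariant, and `[(x+v)/u_k] = [(x+w_k)/u_k] + [v/u_k]` with `‖w_k‖ ≤ 2u_k → 0`, so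
`S n (x+v) = lim S n (x + w_k) = S n x`. Hence in `IsRegular` the translation clause is REDUNDANT for
cluster points (`isRegular_of_clusterPoint`). [cite: FriedliVelenik2017, Thm. 3.17] -/
theorem clusterPoint_translate_of_continuousOn {ρ : ℝ → ℝ} {n : ℕ}
    (hSn : ∃ u : ℕ → ℝ, Tendsto u atTop (𝓝[>] (0 : ℝ)) ∧
      TendstoLocallyUniformlyOn (fun k => rescaledCorrelator (criticalCorr 3) ρ n (u k)) (S n)
        atTop (NonCoincident 3 n))
    (hcont : ContinuousOn (S n) (NonCoincident 3 n)) (v : EuclideanSpace ℝ (Fin 3))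
    {x : Fin n → EuclideanSpace ℝ (Fin 3)} (hx : x ∈ NonCoincident 3 n) :
    S n (fun i => x i + v) = S n x := by
  obtain ⟨u, hu, hconv⟩ := hSn
  set w : ℕ → EuclideanSpace ℝ (Fin 3) := fun k => v - u k • siteVec (latticeApprox (u k) v) with hw
  have hupos : ∀ᶠ k in atTop, 0 < u k := hu.eventually self_mem_nhdsWithin
  -- exact identity of the two zooms
  have hzoom : ∀ᶠ k in atTop, rescaledCorrelator (criticalCorr 3) ρ n (u k) (fun i => x i + w k) =
      rescaledCorrelator (criticalCorr 3) ρ n (u k) (fun i => x i + v) := by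
    filter_upwards [hupos] with k hk
    rw [rescaledCorrelator_apply, rescaledCorrelator_apply]
    congr 1
    have h : (fun i => latticeApprox (u k) (x i + v)) =
        fun i => latticeApprox (u k) (x i + w k) + latticeApprox (u k) v := by
      funext i
      exact latticeApprox_add_eq hk (x i) v
    rw [h, criticalCorr_translate]
  -- `w_k → 0`
  have hw0 : Tendsto w atTop (𝓝 0) := by
    refine squeeze_zero_norm' ?_ ?_ (a := fun k => 2 * u k)
    · filter_upwards [hupos] with k hk using norm_sub_smul_siteVec_latticeApprox_le hk v
    · simpa using (tendsto_nhds_of_tendsto_nhdsWithin hu).const_mul 2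
  have h1 : Tendsto (fun k => rescaledCorrelator (criticalCorr 3) ρ n (u k) (fun i => x i + v)) atTop
      (𝓝 (S n (fun i => x i + v))) := hconv.tendsto_at ((add_mem_nonCoincident_iff v x).2 hx)
  have hg : Tendsto (fun k => fun i => x i + w k) atTop (𝓝[NonCoincident 3 n] x) := by
    refine tendsto_nhdsWithin_iff.2 ⟨?_, Eventually.of_forall fun k => (add_mem_nonCoincident_iff (w k) x).2 hx⟩
    have : Tendsto (fun k => fun i => x i + w k) atTop (𝓝 (fun i => x i + 0)) :=
      tendsto_pi_nhds.2 fun i => tendsto_const_nhds.add hw0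
    simpa using this
  have h2 : Tendsto (fun k => rescaledCorrelator (criticalCorr 3) ρ n (u k) (fun i => x i + w k)) atTop
      (𝓝 (S n x)) := hconv.tendsto_comp (hcont x hx) hx hg
  exact tendsto_nhds_unique (h2.congr' hzoom) h1 |>.symm

/-- **`IsRegular` for cluster points = normalised + continuous off the diagonals**: the
translation-invariance clause is then automatic. [folklore] -/
theorem isRegular_of_clusterPoint (hS : IsClusterPoint S)
    (hnorm : MoebiusLimitExistsOnlyInteraction.IsNormalised S)
    (hcont : ∀ n, ContinuousOn (S n) (NonCoincident 3 n)) :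
    MoebiusLimitExistsOnlyInteraction.IsRegular S := by
  refine ⟨hnorm, hcont, fun n v x => ?_⟩
  by_cases hx : x ∈ NonCoincident 3 n
  · obtain ⟨u, hu, hconv⟩ := hS
    exact clusterPoint_translate_of_continuousOn ⟨u, hu, hconv n⟩ (hcont n) v hx
  · rw [hnorm n _ hx, hnorm n _ (mt (add_mem_nonCoincident_iff v x).1 hx)]

end Summit.CriticalPhenomena.Ising3DConformalLimit.MoebiusLimitExistsNegative

end
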